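import Mathlib
import Literature.AlgebraicGeometry.RelativeSpec.SubringSpec
import Literature.AlgebraicGeometry.RelativeSpec.SubringSpecLift
import Literature.AlgebraicGeometry.RelativeSpec.FiniteGroupQuotient
import Literature.AlgebraicGeometry.RelativeSpec.FiniteGroupQuotientGluing

/-!
# The pieces `O/G` of a glued quotient over an AFFINE base are spectra of invariant rings

Crux stmt-ResolutionOfSingularities-15640 (`WildQuotients.WildQuotientResolution`), line `Sketch`;
programme V3U of CHAIN w45c v5, row **V3U-E (2)** «`pieceQuot O ≅ Spec (invariantsRing)` for affine
`X₁`» (res-L1-w45c-stub-3). [OURS · L1 W4.5c] — generic glue over the Literature relative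
spectrum (`RelativeSpec.SubringDatum`), NOT a statement of the manuscript.

For a subring datum `D` of `f : X → Y` (e.g. the invariants `U ↦ Γ(X, f⁻¹U)^G` of a finite group
acting over `Y`) the relative spectrum `Spec_Y(D)` is glued from the charts `Spec (D.ring U)`,
`U ⊆ Y` affine; when `Y` itself is affine the single chart over `U = ⊤` is an isomorphism
(`isIso_openCover_f_top`), so `Spec_Y(D) ≅ Spec (D.ring ⊤)`, compatibly with the canonical map
`X → Spec_Y(D)` — which over this chart is `X = f⁻¹⊤ → Spec Γ(X, f⁻¹⊤) → Spec (D.ring ⊤)`, the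
second arrow being `Spec` of the inclusion `D.ring ⊤ ⊆ Γ(X, f⁻¹⊤)` (`exists_iso_spec_of_isAffine`).
Specialised to the pieces of `ActionOver.glued`: for a `G`-stable open `O` affine over an affine
base, `O/G ≅ Spec (Γ(O, ⊤)^G)` with `O → O/G` = `Spec` of the inclusion of the invariants
(`exists_iso_spec_pieceQuot`). Consumer: V3U-F (the `A₁`-cone chart `Y_a = O_a/σ` of
`Y = V/σ` as the spectrum of an explicit invariant ring).
-/

-- single-problem summit: the doubled namespace component `ResolutionOfSingularities` is forced
set_option linter.dupNamespace false

noncomputable section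

universe u

open CategoryTheory AlgebraicGeometry TopologicalSpace Opposite
open Literature.AlgebraicGeometry.RelativeSpec

namespace Summit.ResolutionOfSingularities.ResolutionOfSingularities.Theorems.WildQuotientResolution.BlowupExit

section SubringDatum

variable {X Y : Scheme.{u}} {f : X ⟶ Y} (D : SubringDatum f) [QuasiCompact f] [QuasiSeparated f]

/-- **Over an affine base the top chart of the relative spectrum is an isomorphism**: the open
immersion `Spec (D.ring ⊤) → Spec_Y(D)` has image `fromSpec⁻¹ ⊤`, i.e. everything.
[folklore] -/
theorem isIso_openCover_f_top [IsAffine Y] :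
    IsIso (D.openCover.f ⟨⊤, isAffineOpen_top Y⟩) := by
  have hrange : (D.openCover.f ⟨⊤, isAffineOpen_top Y⟩).opensRange = ⊤ := by
    have h := D.fromSpec_preimage ⟨⊤, isAffineOpen_top Y⟩
    rw [Scheme.Hom.preimage_top] at h
    exact h.symm
  have hsurj : Function.Surjective (D.openCover.f ⟨⊤, isAffineOpen_top Y⟩).base := by
    intro z
    have hz : z ∈ (D.openCover.f ⟨⊤, isAffineOpen_top Y⟩).opensRange := by
      rw [hrange]
      exact Opens.mem_top z
    exact hz
  haveI : Epi (D.openCover.f ⟨⊤, isAffineOpen_top Y⟩).base :=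
    (TopCat.epi_iff_surjective _).mpr hsurj
  exact IsOpenImmersion.isIso _

/-- **The relative spectrum over an affine base is the spectrum of the top ring**, compatibly
with the canonical map from `X`: there is `e : Spec (D.ring ⊤) ≅ Spec_Y(D)` with
`(f⁻¹⊤ ↪ X) ≫ toSpec = toSpecΓ ≫ Spec (D.ring ⊤ ⊆ Γ(X, f⁻¹⊤)) ≫ e.hom`. [folklore] -/
theorem exists_iso_spec_of_isAffine [IsAffine Y] :
    ∃ e : Spec (.of (D.ring ⊤)) ≅ D.spec,
      (f ⁻¹ᵁ (⊤ : Y.Opens)).ι ≫ D.toSpec =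
        (f ⁻¹ᵁ (⊤ : Y.Opens)).toSpecΓ ≫
          Spec.map (CommRingCat.ofHom (D.ring ⊤).subtype) ≫ e.hom := by
  refine ⟨@asIso _ _ _ _ (D.openCover.f ⟨⊤, isAffineOpen_top Y⟩) (isIso_openCover_f_top D), ?_⟩
  rw [asIso_hom]
  exact D.ι_lift f D.inclusion ⟨⊤, isAffineOpen_top Y⟩

end SubringDatum

section Pieces

variable {X S : Scheme.{u}} {r : X ⟶ S} {G : Type u} [Group G] [Finite G]
  (ρ : ActionOver r G) [S.IsSeparated] [IsSeparated r]

omit [S.IsSeparated] in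
/-- **The piece `O/G` over an affine base is `Spec` of the invariants of `Γ(O, ⊤)`**, compatibly
with the quotient map `O → O/G`: for a `G`-stable open `O` affine over the affine base `S` there
is `e : Spec (Γ(O, (O → S)⁻¹⊤)^G) ≅ O/G` with
`(⊤ ↪ O) ≫ (O → O/G) = toSpecΓ ≫ Spec (inclusion of the invariants) ≫ e.hom`. [folklore] -/
theorem exists_iso_spec_pieceQuot [IsAffine S] (O : ρ.StableAffineOpens) :
    ∃ e : Spec (.of ((ρ.restrict O.1 O.2.1).invariantsRing ⊤)) ≅ ρ.pieceQuot O,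
      ((O.1.ι ≫ r) ⁻¹ᵁ (⊤ : S.Opens)).ι ≫ ρ.pieceMk O =
        ((O.1.ι ≫ r) ⁻¹ᵁ (⊤ : S.Opens)).toSpecΓ ≫
          Spec.map (CommRingCat.ofHom ((ρ.restrict O.1 O.2.1).invariantsRing ⊤).subtype) ≫ e.hom :=
  exists_iso_spec_of_isAffine (ρ.restrict O.1 O.2.1).invariants

end Pieces

end Summit.ResolutionOfSingularities.ResolutionOfSingularities.Theorems.WildQuotientResolution.BlowupExit

end
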